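import Mathlib.Tactic.Group
import Summits.MatrixMultiplication.MatrixMultiplication.Theses.GelfandPairHosts
import Summits.MatrixMultiplication.MatrixMultiplication.Theorems.GelfandHosting.Negative.AbelianIndex

/-!
# `GelfandHosting` (crux stmt-MatrixMultiplication-7381), line `birth`, stub `stub_saturatedTripleHosts`:
# capacity of block-product hosts `X ↪ Y × Z` with abelian action on the second factor

Negative-side support file of the line lead (2026-08-17); `sorry`-free, no new definitions.

The abelian-index obstruction (`Negative/AbelianIndex`) leaves one kind of multiplicity-free host family
with `D = N^{1+o(1)}` untouched: PRODUCTS `(K × A) ↷ Y × A` of a small host `K ↷ Y` (`|Y| = q`, e.g. `S_q`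
natural, `q ≈ log N`) with an abelian regular one — there `D/N ≈ q` while every abelian subgroup of `K × A`
has index super-polynomial in `q`.  This file bounds their capacity directly:

* `blockProduct_quotientDesign_capacity` — let `G` act on `X`, `Y`, `Z` with an equivariant injection
  `e : X ↪ Y × Z`, and suppose the action on `Z` is through an abelian quotient
  (`g • g' • z = g' • g • z`).  Then every quotient-form design has `|F|·|Hs|·|P| ≤ |Z|·|Y|³`
  (`= N·q²` when `e` is a bijection): the map `(f,h,p) ↦ (π_Y p, f h⁻¹ • π_Z p, f • π_Y p, h • π_Y p)`
  is injective by the design condition.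
* `blockProduct_saturatedTriple_capacity` — the same for stabiliser-saturated TPP triples (vocabulary of
  `stub_saturatedTripleHosts`): `|S|·|T|·|U • x₀| ≤ |Z|·|Y|³`.

So a product host `(K × A) ↷ Y × A` carries no stub-3 witness at exponent `ε` unless
`N³ ≤ (q² N)^{2+ε}` (as in `saturatedTriple_witness_index` with `k² ↦ q²`), which together with
`q ≲ D/N ≤ N^{3ε/4}` forces `ε ≥ 0.24`; the bound `abc ≤ q²N` is polynomial in `q = |Y|`, not in `|K|`.
-/

-- the tree's namespace `Summit.MatrixMultiplication.MatrixMultiplication.…` repeats a component by design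
set_option linter.dupNamespace false

namespace Summit.MatrixMultiplication.MatrixMultiplication.Theorems.GelfandHosting.Negative

/-- **Block-product capacity bound (quotient form).** Let the group `G` act on `X`, `Y` and `Z`, let
`e : X → Y × Z` be an injective equivariant map (`e (g • x) = (g • (e x).1, g • (e x).2)`), and let the
action on `Z` be abelian (`g • g' • z = g' • g • z`).  Then every quotient-form design `(F, Hs, P)` in
`X` — `(f'⁻¹ f h⁻¹ h') • p = p' ⇒ f = f' ∧ h = h' ∧ p = p'` — satisfies
`|F|·|Hs|·|P| ≤ |Z|·|Y|³`: the map `(f, h, p) ↦ ((e p).1, f • h⁻¹ • (e p).2, f • (e p).1, h • (e p).1)`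
into `Y × Z × Y × Y` is injective (a collision makes `f'⁻¹ f h⁻¹ h'` carry `p` to `p'`). [folklore] -/
theorem blockProduct_quotientDesign_capacity {G X Y Z : Type} [Group G] [MulAction G X]
    [MulAction G Y] [MulAction G Z] [Fintype Y] [Fintype Z] [DecidableEq Y] [DecidableEq Z]
    (e : X → Y × Z) (he : Function.Injective e)
    (hact : ∀ (g : G) (x : X), e (g • x) = (g • (e x).1, g • (e x).2))
    (hcomm : ∀ (g g' : G) (z : Z), g • g' • z = g' • g • z)
    (F Hs : Finset G) (P : Finset X)
    (hdes : ∀ f ∈ F, ∀ f' ∈ F, ∀ h ∈ Hs, ∀ h' ∈ Hs, ∀ p ∈ P, ∀ p' ∈ P,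
      (f'⁻¹ * f * h⁻¹ * h') • p = p' → f = f' ∧ h = h' ∧ p = p') :
    F.card * Hs.card * P.card ≤ Fintype.card Z * Fintype.card Y ^ 3 := by
  classical
  let Ψ : G × G × X → Y × Z × Y × Y :=
    fun t => ((e t.2.2).1, t.1 • t.2.1⁻¹ • (e t.2.2).2, t.1 • (e t.2.2).1, t.2.1 • (e t.2.2).1)
  have hinj : Set.InjOn Ψ ↑(F ×ˢ (Hs ×ˢ P)) := by
    rintro ⟨f, h, p⟩ hm ⟨f', h', p'⟩ hm' heq
    simp only [Finset.coe_product, Set.mem_prod, Finset.mem_coe] at hm hm'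
    obtain ⟨hf, hh, hp⟩ := hm
    obtain ⟨hf', hh', hp'⟩ := hm'
    simp only [Ψ, Prod.mk.injEq] at heq
    obtain ⟨e1, e2, e3, e4⟩ := heq
    rw [← e1] at e3 e4
    -- the element `g = f'⁻¹ f h⁻¹ h'` carries `p` to `p'`
    have key : (f'⁻¹ * f * h⁻¹ * h') • p = p' := by
      apply he
      rw [hact, Prod.ext_iff]
      constructor
      · -- `Y`-coordinate: `h' • y = h • y` and `f • y = f' • y`
        show (f'⁻¹ * f * h⁻¹ * h') • (e p).1 = (e p').1
        rw [← e1, mul_smul, mul_smul, mul_smul, ← e4, inv_smul_smul, e3, inv_smul_smul]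
      · -- `Z`-coordinate: commutativity moves `h'` to the front
        show (f'⁻¹ * f * h⁻¹ * h') • (e p).2 = (e p').2
        have hz : (e p').2 = h' • f'⁻¹ • (f • h⁻¹ • (e p).2) := by
          rw [e2, smul_smul, smul_smul, smul_smul]
          simp
        rw [hz, mul_smul, mul_smul, mul_smul, hcomm h⁻¹ h', hcomm f h', hcomm f'⁻¹ h']
    obtain ⟨r1, r2, r3⟩ := hdes f hf f' hf' h hh h' hh' p hp p' hp' key
    subst r1 r2 r3
    rfl
  calc F.card * Hs.card * P.card
      = (F ×ˢ (Hs ×ˢ P)).card := by rw [Finset.card_product, Finset.card_product, mul_assoc]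
    _ = ((F ×ˢ (Hs ×ˢ P)).image Ψ).card := (Finset.card_image_of_injOn hinj).symm
    _ ≤ Fintype.card (Y × Z × Y × Y) := Finset.card_le_univ _
    _ = Fintype.card Z * Fintype.card Y ^ 3 := by
        simp only [Fintype.card_prod]; ring

/-- **Block-product capacity bound for saturated TPP triples.** In the setting of
`blockProduct_quotientDesign_capacity`, a TPP triple `(S,T,U)` of `G` whose third leg is right-saturated
by the stabiliser of `x₀ : X` has `|S|·|T|·|U • x₀| ≤ |Z|·|Y|³`. [folklore] -/
theorem blockProduct_saturatedTriple_capacity {G X Y Z : Type} [Group G] [MulAction G X]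
    [MulAction G Y] [MulAction G Z] [Fintype Y] [Fintype Z] [DecidableEq X] [DecidableEq Y]
    [DecidableEq Z] (e : X → Y × Z) (he : Function.Injective e)
    (hact : ∀ (g : G) (x : X), e (g • x) = (g • (e x).1, g • (e x).2))
    (hcomm : ∀ (g g' : G) (z : Z), g • g' • z = g' • g • z) (x₀ : X) (S T U : Finset G)
    (htpp : ∀ s ∈ S, ∀ s' ∈ S, ∀ t ∈ T, ∀ t' ∈ T, ∀ u ∈ U, ∀ u' ∈ U,
      s * s'⁻¹ * (t * t'⁻¹) * (u * u'⁻¹) = 1 → s = s' ∧ t = t' ∧ u = u')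
    (hsat : ∀ u ∈ U, ∀ h : G, h • x₀ = x₀ → u * h ∈ U) :
    S.card * T.card * (U.image fun u => u • x₀).card ≤ Fintype.card Z * Fintype.card Y ^ 3 := by
  classical
  have h := blockProduct_quotientDesign_capacity e he hact hcomm (S.image (·⁻¹)) (T.image (·⁻¹))
    (U.image (· • x₀)) (quotientDesign_of_saturatedTriple x₀ S T U htpp hsat)
  rwa [Finset.card_image_of_injective _ inv_injective,
    Finset.card_image_of_injective _ inv_injective] at h

end Summit.MatrixMultiplication.MatrixMultiplication.Theorems.GelfandHosting.Negative
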